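import Mathlib
import Summits.NavierStokesRegularity.NavierStokesRegularity.Theorems.WakeRatchetTailRatchetRelayFixedPoint
import HarnessLib

/-!
# `WakeRatchet.TailRatchet` (stmt-NavierStokesRegularity-21808): UNIQUENESS of the lacunary front in the
# weighted ball — the branch `s ↦ (h_s, δ_s)` is well defined

Support file for the crux `TailRatchet` (route `WakeRatchet`; MODEL lattice ODEs of Tao 2016 §1.2, §4 —
nothing in this file is a statement about the Navier–Stokes equations, and no item is closed here).

Context (programme "R-lac" of the census of stmt-21808; base camp for the continuation programme
"R-glob"/"R-cont"): `…RelayFront.relay_front_exists` produces, at every `s ∈ [2 − 10⁻²⁶, 2]`, a solution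
`(h, δ)` of the scalar front problem in the weighted ball `|h| ≤ 8Kη e^{t/2}`, `|δ| ≤ 8Kη`, `h(0) = 0`
(`η = 2 − s`, `K = 1100000`).  This file proves it is the ONLY one there:

* `relay_front_unique` — two solutions `(h₁, δ₁)`, `(h₂, δ₂)` of `b' = (4/s²)b(t/s)² − 4sδ·b(t)b(st)`
  (`b = e^{t} + h`) on `t < 0` with `hᵢ` continuous on `(−∞,0]`, `hᵢ(0) = 0`, `|hᵢ| ≤ 8Kη e^{t/2}`,
  `|δᵢ| ≤ 8Kη` coincide: `δ₁ = δ₂` and `h₁ = h₂` on `(−∞, 0]`.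

Proof: both are fixed points of the Picard map, and `…RelayContraction.picard_contract` halves every
admissible weighted distance bound; the initial bound comes from the equation itself.

HONEST FRAMING: MODEL lattice only; lacunary fronts (LARGE `ε₀`) do NOT refute `TailRatchet` (which needs
`Λ → 1`); the construction item and the crux stay open.
-/

noncomputable section

set_option linter.dupNamespace false

namespace Summit.NavierStokesRegularity.NavierStokesRegularity.Theorems

namespace WakeRatchetRelayFrontUnique

open Set Filter Topology MeasureTheory
open WakeRatchetRelayNonlinearMap WakeRatchetRelayContraction WakeRatchetRelayFixedPoint

/-- Crude weighted bound for the front right-hand side minus `e^{t}`: for `3/2 ≤ s ≤ 2`, `|h| ≤ re^{ξ/2}` on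
`ξ ≤ 0`, `|δ| ≤ r`, and `t < 0`,
`|(4/s²)(e^{t/s}+h(t/s))² − 4sδ(e^{t}+h(t))(e^{st}+h(st)) − e^{t}| ≤ (2(1+r)² + 8r(1+r)² + 1)e^{t/2}`.
[folklore] -/
theorem front_rhs_crude {s r : ℝ} (hs1 : 3 / 2 ≤ s) (hs2 : s ≤ 2) {h : ℝ → ℝ} {δ : ℝ}
    (hρ : ∀ ξ : ℝ, ξ ≤ 0 → |h ξ| ≤ r * Real.exp (ξ / 2)) (hδ : |δ| ≤ r) {t : ℝ} (ht : t < 0) :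
    |4 / s ^ 2 * (Real.exp (t / s) + h (t / s)) ^ 2
        - 4 * s * δ * ((Real.exp t + h t) * (Real.exp (s * t) + h (s * t))) - Real.exp t| ≤
      (2 * (1 + r) ^ 2 + 8 * r * (1 + r) ^ 2 + 1) * Real.exp (t / 2) := by
  have hs0 : 0 < s := by linarith
  have hr0 : 0 ≤ r := by
    have := hρ 0 le_rfl; rw [zero_div, Real.exp_zero, mul_one] at this; exact (abs_nonneg _).trans this
  have e2 : 0 < Real.exp (t / 2) := Real.exp_pos _
  have hts : t / s ≤ 0 := div_nonpos_of_nonpos_of_nonneg ht.le hs0.le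
  have hst : s * t ≤ 0 := mul_nonpos_of_nonneg_of_nonpos hs0.le ht.le
  -- `|e^{t/s} + h(t/s)| ≤ (1+r) e^{t/4}`
  have hq1 : Real.exp (t / s) ≤ Real.exp (t / 4) := Real.exp_le_exp.2 (by
    rw [div_le_div_iff₀ hs0 (by norm_num)]; nlinarith)
  have hq2 : |h (t / s)| ≤ r * Real.exp (t / 4) := (hρ _ hts).trans (by
    have : Real.exp (t / s / 2) ≤ Real.exp (t / 4) := Real.exp_le_exp.2 (by
      rw [div_div, div_le_div_iff₀ (by positivity) (by norm_num)]; nlinarith)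
    exact mul_le_mul_of_nonneg_left this hr0)
  have hq : |Real.exp (t / s) + h (t / s)| ≤ (1 + r) * Real.exp (t / 4) := by
    calc _ ≤ |Real.exp (t / s)| + |h (t / s)| := abs_add_le _ _
      _ ≤ Real.exp (t / 4) + r * Real.exp (t / 4) := by rw [abs_of_pos (Real.exp_pos _)]; linarith
      _ = (1 + r) * Real.exp (t / 4) := by ring
  have hQ : |4 / s ^ 2 * (Real.exp (t / s) + h (t / s)) ^ 2| ≤ 2 * (1 + r) ^ 2 * Real.exp (t / 2) := by
    rw [abs_mul, abs_of_pos (by positivity : (0 : ℝ) < 4 / s ^ 2), abs_pow]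
    have h49 : 4 / s ^ 2 ≤ (2 : ℝ) := by rw [div_le_iff₀ (by positivity)]; nlinarith
    have hsq : |Real.exp (t / s) + h (t / s)| ^ 2 ≤ ((1 + r) * Real.exp (t / 4)) ^ 2 :=
      pow_le_pow_left₀ (abs_nonneg _) hq 2
    have he : ((1 + r) * Real.exp (t / 4)) ^ 2 = (1 + r) ^ 2 * Real.exp (t / 2) := by
      rw [mul_pow, sq (Real.exp (t / 4)), ← Real.exp_add]; ring_nf
    rw [he] at hsq
    calc 4 / s ^ 2 * |Real.exp (t / s) + h (t / s)| ^ 2 ≤ 2 * ((1 + r) ^ 2 * Real.exp (t / 2)) :=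
          mul_le_mul h49 hsq (by positivity) (by norm_num)
      _ = 2 * (1 + r) ^ 2 * Real.exp (t / 2) := by ring
  -- the drain term
  have hb1 : |Real.exp t + h t| ≤ (1 + r) * Real.exp (t / 2) := by
    have he : Real.exp t ≤ Real.exp (t / 2) := Real.exp_le_exp.2 (by linarith)
    calc _ ≤ |Real.exp t| + |h t| := abs_add_le _ _
      _ ≤ Real.exp (t / 2) + r * Real.exp (t / 2) := by
          rw [abs_of_pos (Real.exp_pos _)]; linarith [hρ t ht.le]
      _ = (1 + r) * Real.exp (t / 2) := by ring
  have hb2 : |Real.exp (s * t) + h (s * t)| ≤ 1 + r := by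
    have he : Real.exp (s * t) ≤ 1 := Real.exp_le_one_iff.2 hst
    have hh : |h (s * t)| ≤ r := (hρ _ hst).trans (by
      have : Real.exp (s * t / 2) ≤ 1 := Real.exp_le_one_iff.2 (by linarith); nlinarith)
    calc _ ≤ |Real.exp (s * t)| + |h (s * t)| := abs_add_le _ _
      _ ≤ 1 + r := by rw [abs_of_pos (Real.exp_pos _)]; linarith
  have hD : |4 * s * δ * ((Real.exp t + h t) * (Real.exp (s * t) + h (s * t)))| ≤
      8 * r * (1 + r) ^ 2 * Real.exp (t / 2) := by
    rw [abs_mul, abs_mul, abs_mul, abs_of_pos (by norm_num : (0 : ℝ) < 4), abs_of_pos hs0, abs_mul]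
    have h1 : |Real.exp t + h t| * |Real.exp (s * t) + h (s * t)| ≤ (1 + r) * Real.exp (t / 2) * (1 + r) :=
      mul_le_mul hb1 hb2 (abs_nonneg _) (by positivity)
    calc 4 * s * |δ| * (|Real.exp t + h t| * |Real.exp (s * t) + h (s * t)|)
        ≤ 4 * 2 * r * ((1 + r) * Real.exp (t / 2) * (1 + r)) := by
          apply mul_le_mul _ h1 (by positivity) (by positivity)
          nlinarith [abs_nonneg δ]
      _ = 8 * r * (1 + r) ^ 2 * Real.exp (t / 2) := by ring
  have hE : |Real.exp t| ≤ 1 * Real.exp (t / 2) := by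
    rw [abs_of_pos (Real.exp_pos _), one_mul]; exact Real.exp_le_exp.2 (by linarith)
  calc _ ≤ |4 / s ^ 2 * (Real.exp (t / s) + h (t / s)) ^ 2
          - 4 * s * δ * ((Real.exp t + h t) * (Real.exp (s * t) + h (s * t)))| + |Real.exp t| := abs_sub _ _
    _ ≤ |4 / s ^ 2 * (Real.exp (t / s) + h (t / s)) ^ 2| +
          |4 * s * δ * ((Real.exp t + h t) * (Real.exp (s * t) + h (s * t)))| + |Real.exp t| := by
        linarith [abs_sub (4 / s ^ 2 * (Real.exp (t / s) + h (t / s)) ^ 2)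
          (4 * s * δ * ((Real.exp t + h t) * (Real.exp (s * t) + h (s * t))))]
    _ ≤ _ := by nlinarith [hQ, hD, hE, e2]

/-- **UNIQUENESS OF THE LACUNARY FRONT IN THE WEIGHTED BALL.**  For `s ∈ [2 − 10⁻²⁶, 2]`, `η = 2 − s`,
two solutions `b = e^{t} + hᵢ` (`i = 1,2`) of `b' = (4/s²)b(t/s)² − 4sδᵢ·b(t)b(st)` on `t < 0` with `hᵢ`
continuous on `(−∞,0]`, `hᵢ(0) = 0`, `|hᵢ(t)| ≤ 8800000·η·e^{t/2}`, `|δᵢ| ≤ 8800000·η` coincide.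
[cite: Tao2016AveragedNS, §1.2 (dyadic model); cell vocabulary (scalar front equation of `DyadicScalarFronts`; programme R-lac of the census of stmt-21808)] -/
theorem relay_front_unique {s : ℝ} (hs1 : 2 - 1 / 10 ^ 26 ≤ s) (hs2 : s ≤ 2)
    {h₁ h₂ : ℝ → ℝ} {δ₁ δ₂ : ℝ}
    (hc₁ : ContinuousOn h₁ (Iic 0)) (hc₂ : ContinuousOn h₂ (Iic 0)) (h0₁ : h₁ 0 = 0) (h0₂ : h₂ 0 = 0)
    (hρ₁ : ∀ t : ℝ, t ≤ 0 → |h₁ t| ≤ 8800000 * (2 - s) * Real.exp (t / 2))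
    (hρ₂ : ∀ t : ℝ, t ≤ 0 → |h₂ t| ≤ 8800000 * (2 - s) * Real.exp (t / 2))
    (hδ₁ : |δ₁| ≤ 8800000 * (2 - s)) (hδ₂ : |δ₂| ≤ 8800000 * (2 - s))
    (hf₁ : ∀ t : ℝ, t < 0 → HasDerivAt (fun x => Real.exp x + h₁ x)
        (4 / s ^ 2 * (Real.exp (t / s) + h₁ (t / s)) ^ 2
          - 4 * s * δ₁ * ((Real.exp t + h₁ t) * (Real.exp (s * t) + h₁ (s * t)))) t)
    (hf₂ : ∀ t : ℝ, t < 0 → HasDerivAt (fun x => Real.exp x + h₂ x)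
        (4 / s ^ 2 * (Real.exp (t / s) + h₂ (t / s)) ^ 2
          - 4 * s * δ₂ * ((Real.exp t + h₂ t) * (Real.exp (s * t) + h₂ (s * t)))) t) :
    δ₁ = δ₂ ∧ ∀ t : ℝ, t ≤ 0 → h₁ t = h₂ t := by
  -- constants
  set η : ℝ := 2 - s with hη
  have hη0 : 0 ≤ η := by rw [hη]; linarith
  have hη1 : η ≤ 1 / 10 ^ 26 := by rw [hη]; linarith
  have hs32 : (3 : ℝ) / 2 ≤ s := by
    have : (1 : ℝ) / 10 ^ 26 ≤ 1 / 2 := by norm_num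
    linarith
  have hs0 : 0 < s := by linarith
  have habs : |s - 2| = η := by rw [hη, abs_sub_comm]; exact abs_of_nonneg (by linarith)
  set r : ℝ := 8800000 * η with hr
  have hr0 : 0 ≤ r := by rw [hr]; positivity
  set κ : ℝ := 1100000 * (22 * η + 36 * r + 32 * r ^ 2) with hκ
  have hκ0 : 0 ≤ κ := by rw [hκ]; positivity
  have hκhalf : κ ≤ 1 / 2 := by rw [hκ, hr]; exact contraction_ineq hη0 hη1
  have hκ1 : κ < 1 := by linarith
  have hcontr : 1100000 * (22 * |s - 2| + 36 * r + 32 * r ^ 2) = κ := by rw [habs]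
  -- continuous extensions to `ℝ` agreeing on `(−∞, 0]`
  set g₁ : ℝ → ℝ := fun t => h₁ (min t 0) with hg₁
  set g₂ : ℝ → ℝ := fun t => h₂ (min t 0) with hg₂
  have hmin : Continuous fun t : ℝ => min t 0 := continuous_id.min continuous_const
  have hmin_mem : ∀ t : ℝ, min t 0 ∈ Iic (0 : ℝ) := fun t => min_le_right t 0
  have hgc₁ : Continuous g₁ := hc₁.comp_continuous hmin hmin_mem
  have hgc₂ : Continuous g₂ := hc₂.comp_continuous hmin hmin_mem
  have heq₁ : ∀ t : ℝ, t ≤ 0 → g₁ t = h₁ t := fun t ht => by simp only [hg₁, min_eq_left ht]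
  have heq₂ : ∀ t : ℝ, t ≤ 0 → g₂ t = h₂ t := fun t ht => by simp only [hg₂, min_eq_left ht]
  -- it suffices to prove the claim for the extensions
  suffices H : δ₁ = δ₂ ∧ ∀ t : ℝ, t ≤ 0 → g₁ t = g₂ t by
    exact ⟨H.1, fun t ht => by rw [← heq₁ t ht, ← heq₂ t ht]; exact H.2 t ht⟩
  -- transfer of the hypotheses to the extensions
  have hgρ₁ : ∀ t : ℝ, t ≤ 0 → |g₁ t| ≤ r * Real.exp (t / 2) := fun t ht => by
    rw [heq₁ t ht]; exact hρ₁ t ht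
  have hgρ₂ : ∀ t : ℝ, t ≤ 0 → |g₂ t| ≤ r * Real.exp (t / 2) := fun t ht => by
    rw [heq₂ t ht]; exact hρ₂ t ht
  have hgδ₁ : |δ₁| ≤ r := hδ₁
  have hgδ₂ : |δ₂| ≤ r := hδ₂
  have hg0₁ : g₁ 0 = 0 := by rw [heq₁ 0 le_rfl, h0₁]
  have hg0₂ : g₂ 0 = 0 := by rw [heq₂ 0 le_rfl, h0₂]
  have hgB₁ : ∀ t : ℝ, t ≤ 0 → |g₁ t| ≤ r := fun t ht => (hgρ₁ t ht).trans (by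
    have : Real.exp (t / 2) ≤ 1 := Real.exp_le_one_iff.2 (by linarith); nlinarith)
  have hgB₂ : ∀ t : ℝ, t ≤ 0 → |g₂ t| ≤ r := fun t ht => (hgρ₂ t ht).trans (by
    have : Real.exp (t / 2) ≤ 1 := Real.exp_le_one_iff.2 (by linarith); nlinarith)
  have htend : ∀ {g : ℝ → ℝ}, (∀ t : ℝ, t ≤ 0 → |g t| ≤ r * Real.exp (t / 2)) →
      Tendsto g atBot (𝓝 0) := by
    intro g hg
    have h0 : Tendsto (fun t : ℝ => r * Real.exp (t / 2)) atBot (𝓝 0) := by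
      have := (Real.tendsto_exp_atBot.comp (tendsto_id.atBot_div_const (by norm_num : (0:ℝ) < 2))).const_mul r
      rwa [mul_zero] at this
    refine squeeze_zero_norm' ?_ h0
    filter_upwards [eventually_le_atBot (0 : ℝ)] with t ht
    rw [Real.norm_eq_abs]; exact hg t ht
  have hgl₁ : Tendsto g₁ atBot (𝓝 0) := htend hgρ₁
  have hgl₂ : Tendsto g₂ atBot (𝓝 0) := htend hgρ₂
  -- the derivatives (front form minus `e^{t}`), in the bordered form
  have hder : ∀ {g h : ℝ → ℝ} {δ : ℝ}, (∀ t : ℝ, t ≤ 0 → g t = h t) →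
      (∀ t : ℝ, t < 0 → HasDerivAt (fun x => Real.exp x + h x)
        (4 / s ^ 2 * (Real.exp (t / s) + h (t / s)) ^ 2
          - 4 * s * δ * ((Real.exp t + h t) * (Real.exp (s * t) + h (s * t)))) t) →
      ∀ t : ℝ, t < 0 → HasDerivAt g
        (2 * Real.exp (t / 2) * g (t / 2) +
          (((-(Real.exp t - 4 / s ^ 2 * Real.exp (2 * t / s)) -
              (2 * Real.exp (t / 2) * g (t / 2) - 8 / s ^ 2 * Real.exp (t / s) * g (t / s)) +
              4 / s ^ 2 * g (t / s) ^ 2 -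
              δ * (4 * s * ((Real.exp t + g t) * (Real.exp (s * t) + g (s * t))) - 8 * Real.exp (3 * t))))
            - δ * (8 * Real.exp (3 * t)))) t := by
    intro g h δ heq hf t ht
    have hts : t / s ≤ 0 := div_nonpos_of_nonpos_of_nonneg ht.le hs0.le
    have hst : s * t ≤ 0 := mul_nonpos_of_nonneg_of_nonpos hs0.le ht.le
    -- `h` has the derivative (front form) − e^t at `t`
    have h1 : HasDerivAt h (4 / s ^ 2 * (Real.exp (t / s) + h (t / s)) ^ 2
          - 4 * s * δ * ((Real.exp t + h t) * (Real.exp (s * t) + h (s * t))) - Real.exp t) t := by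
      have := (hf t ht).sub (Real.hasDerivAt_exp t)
      refine this.congr_of_eventuallyEq ?_ |>.congr_deriv rfl
      exact Eventually.of_forall fun x => by simp
    -- `g = h` near `t`
    have h2 : HasDerivAt g (4 / s ^ 2 * (Real.exp (t / s) + h (t / s)) ^ 2
          - 4 * s * δ * ((Real.exp t + h t) * (Real.exp (s * t) + h (s * t))) - Real.exp t) t := by
      refine h1.congr_of_eventuallyEq ?_
      filter_upwards [Iio_mem_nhds ht] with x hx
      exact heq x (le_of_lt hx)
    refine h2.congr_deriv ?_
    rw [← heq _ hts, ← heq _ ht.le, ← heq _ hst, front_iff_bordered (s := s) (δ := δ) (h := g) t]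
  have hgd₁ := hder heq₁ hf₁
  have hgd₂ := hder heq₂ hf₂
  -- name the derivative functions
  set F₁ : ℝ → ℝ := fun t => 2 * Real.exp (t / 2) * g₁ (t / 2) +
      (((-(Real.exp t - 4 / s ^ 2 * Real.exp (2 * t / s)) -
          (2 * Real.exp (t / 2) * g₁ (t / 2) - 8 / s ^ 2 * Real.exp (t / s) * g₁ (t / s)) +
          4 / s ^ 2 * g₁ (t / s) ^ 2 -
          δ₁ * (4 * s * ((Real.exp t + g₁ t) * (Real.exp (s * t) + g₁ (s * t))) - 8 * Real.exp (3 * t))))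
        - δ₁ * (8 * Real.exp (3 * t))) with hF₁
  set F₂ : ℝ → ℝ := fun t => 2 * Real.exp (t / 2) * g₂ (t / 2) +
      (((-(Real.exp t - 4 / s ^ 2 * Real.exp (2 * t / s)) -
          (2 * Real.exp (t / 2) * g₂ (t / 2) - 8 / s ^ 2 * Real.exp (t / s) * g₂ (t / s)) +
          4 / s ^ 2 * g₂ (t / s) ^ 2 -
          δ₂ * (4 * s * ((Real.exp t + g₂ t) * (Real.exp (s * t) + g₂ (s * t))) - 8 * Real.exp (3 * t))))
        - δ₂ * (8 * Real.exp (3 * t))) with hF₂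
  have hgd₁' : ∀ t : ℝ, t < 0 → HasDerivAt g₁ (F₁ t) t := fun t ht => by
    simpa only [hF₁] using hgd₁ t ht
  have hgd₂' : ∀ t : ℝ, t < 0 → HasDerivAt g₂ (F₂ t) t := fun t ht => by
    simpa only [hF₂] using hgd₂ t ht
  -- crude initial bound on everything
  set D : ℝ := 2 * (1 + r) ^ 2 + 8 * r * (1 + r) ^ 2 + 1 with hD
  have hD1 : r ≤ D := by rw [hD]; nlinarith
  have hFb : ∀ {g : ℝ → ℝ} {δ : ℝ} {F : ℝ → ℝ}, (∀ t : ℝ, t ≤ 0 → |g t| ≤ r * Real.exp (t / 2)) →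
      |δ| ≤ r → (F = fun t => 2 * Real.exp (t / 2) * g (t / 2) +
      (((-(Real.exp t - 4 / s ^ 2 * Real.exp (2 * t / s)) -
          (2 * Real.exp (t / 2) * g (t / 2) - 8 / s ^ 2 * Real.exp (t / s) * g (t / s)) +
          4 / s ^ 2 * g (t / s) ^ 2 -
          δ * (4 * s * ((Real.exp t + g t) * (Real.exp (s * t) + g (s * t))) - 8 * Real.exp (3 * t))))
        - δ * (8 * Real.exp (3 * t)))) →
      ∀ t : ℝ, t < 0 → |F t| ≤ D * Real.exp (t / 2) := by
    intro g δ F hg hδ hF t ht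
    rw [hF]
    simp only []
    rw [← front_iff_bordered (s := s) (δ := δ) (h := g) t]
    exact front_rhs_crude hs32 hs2 hg hδ ht
  have hF₁b := hFb hgρ₁ hgδ₁ hF₁
  have hF₂b := hFb hgρ₂ hgδ₂ hF₂
  -- geometric improvement of the difference bounds
  have hIter : ∀ n : ℕ, (∀ t : ℝ, t ≤ 0 → |g₁ t - g₂ t| ≤ 2 * D * κ ^ n * Real.exp (t / 2)) ∧
      (∀ t : ℝ, t < 0 → |F₁ t - F₂ t| ≤ 2 * D * κ ^ n * Real.exp (t / 2)) ∧
      |δ₁ - δ₂| ≤ 2 * D * κ ^ n := by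
    intro n
    induction n with
    | zero =>
      refine ⟨fun t ht => ?_, fun t ht => ?_, ?_⟩
      · rw [pow_zero, mul_one]
        calc |g₁ t - g₂ t| ≤ |g₁ t| + |g₂ t| := abs_sub _ _
          _ ≤ r * Real.exp (t / 2) + r * Real.exp (t / 2) := add_le_add (hgρ₁ t ht) (hgρ₂ t ht)
          _ ≤ 2 * D * Real.exp (t / 2) := by nlinarith [Real.exp_pos (t / 2)]
      · rw [pow_zero, mul_one]
        calc |F₁ t - F₂ t| ≤ |F₁ t| + |F₂ t| := abs_sub _ _
          _ ≤ D * Real.exp (t / 2) + D * Real.exp (t / 2) := add_le_add (hF₁b t ht) (hF₂b t ht)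
          _ = 2 * D * Real.exp (t / 2) := by ring
      · rw [pow_zero, mul_one]
        calc |δ₁ - δ₂| ≤ |δ₁| + |δ₂| := abs_sub _ _
          _ ≤ r + r := add_le_add hgδ₁ hgδ₂
          _ ≤ 2 * D := by linarith
    | succ n ih =>
      obtain ⟨ih1, ih2, ih3⟩ := ih
      have hC := picard_contract (μ := 2 * D * κ ^ n) hs32 hs2 hgc₁ hgc₂ hgd₁' hgd₂' hgρ₁ hgρ₂ hgδ₁
        hgc₁ hgc₂ hg0₁ hg0₂ hgl₁ hgl₂ hgB₁ hgB₂ hgd₁ hgd₂ ih1 ih2 ih3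
      rw [hcontr] at hC
      obtain ⟨hC1, hC2, hC3⟩ := hC
      have hpow : κ * (2 * D * κ ^ n) = 2 * D * κ ^ (n + 1) := by ring
      refine ⟨fun t ht => ?_, fun t ht => ?_, ?_⟩
      · have := hC2 t ht; rwa [hpow] at this
      · have := hC3 t ht.le
        rw [hpow] at this
        simpa only [hF₁, hF₂] using this
      · have := hC1; rwa [hpow] at this
  -- the bounds tend to zero
  have hgeo : Tendsto (fun n : ℕ => 2 * D * κ ^ n) atTop (𝓝 0) := by
    have := (tendsto_pow_atTop_nhds_zero_of_lt_one hκ0 hκ1).const_mul (2 * D)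
    rwa [mul_zero] at this
  refine ⟨?_, fun t ht => ?_⟩
  · have h : |δ₁ - δ₂| ≤ 0 := ge_of_tendsto' hgeo fun n => (hIter n).2.2
    have := abs_nonneg (δ₁ - δ₂)
    have : δ₁ - δ₂ = 0 := abs_eq_zero.1 (le_antisymm h this)
    linarith
  · have hgeo' : Tendsto (fun n : ℕ => 2 * D * κ ^ n * Real.exp (t / 2)) atTop (𝓝 0) := by
      have := hgeo.mul_const (Real.exp (t / 2)); rwa [zero_mul] at this
    have h : |g₁ t - g₂ t| ≤ 0 := ge_of_tendsto' hgeo' fun n => (hIter n).1 t ht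
    have := abs_nonneg (g₁ t - g₂ t)
    have : g₁ t - g₂ t = 0 := abs_eq_zero.1 (le_antisymm h this)
    linarith

end WakeRatchetRelayFrontUnique

end Summit.NavierStokesRegularity.NavierStokesRegularity.Theorems

end
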